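import Mathlib
import Literature.Probability.LatticeModels.GKSInequalities
import HarnessLib

/-!
# Crux `PrecisionLaplacian.InverseMFerromagnet` (stmt-CriticalPhenomena-4798), line `Sketch` —
# stub `stub_wheel_ringsum` (Theorem W, wheels: the apex reduction to ring sums)

THEOREM-ONLY file (no definitions).  The wheel `W_n` (`n ≥ 3`): sites `Fin (n+1)` with hub
`Fin.last n` and rim `k.castSucc`; bonds `Fin (n+n) = Fin.append (rim bonds {k, k+1}) (spokes {hub, k})`
with couplings `Kw = Fin.append K h`, in the vocabulary `gksExpect Finset.univ Kw C` of
`Literature/Probability/LatticeModels/GKSInequalities.lean`.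

**Apex reduction.**  Writing a wheel configuration as `ω = Fin.snoc (s • y) s` (hub spin `s`, rim
configuration `y` *relative to the hub*), the Boltzmann weight is the ring weight with a field,
`w y = exp(∑ K_k y_k y_{k+1} + ∑ h_k y_k)`, independently of `s`; hence every pair expectation of the
wheel is a ratio of ring sums: `Z_wheel = 2 Zr`, `Z⟨σ_iσ_j⟩ = 2 B i j`, `Z⟨σ_hub σ_i⟩ = 2 A i`
(`wrs_gksSum`).  Positivity of `A i` for `K ≥ 0`, `h > 0`: by Griffiths' comparison inequality
(`gksExpect_mono_of_abs_le`) `A i / Zr = ⟨σ_hub σ_i⟩_wheel ≥ ⟨σ_hub σ_i⟩_{single spoke i} > 0`, the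
last expectation being a ratio of the explicit sums `∑_y y_i e^{h_i y_i} > 0` (pair `y` with `-y`)
and `∑_y e^{h_i y_i} > 0`.
-/

namespace Summit.CriticalPhenomena.Ising3DConformalLimit.Cruxes.InverseMFerromagnet.PartialCovarianceLadder

open Literature.Probability.LatticeModels Finset Matrix

noncomputable section

/-! ## Small algebraic facts -/

/-- `finRotate n` has no fixed point for `n ≥ 2`. [folklore] -/
private theorem wrs_finRotate_ne {n : ℕ} (hn : 2 ≤ n) (k : Fin n) : finRotate n k ≠ k :=
  Equiv.Perm.mem_support.1 (by rw [support_finRotate_of_le hn]; exact Finset.mem_univ k)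

/-- `σ_{{a,b}} = σ_a σ_b` for `a ≠ b`. [folklore] -/
private theorem wrs_spinProduct_pair {V : Type*} [DecidableEq V] {a b : V} (hab : a ≠ b)
    (ω : SpinConfig V) : spinProduct ({a, b} : Finset V) ω = spinAt a ω * spinAt b ω := by
  rw [spinProduct, Finset.prod_pair hab]

/-- `(s a)(s b) = a b` in `ℤˣ`. [folklore] -/
private theorem wrs_units_cancel (s a b : ℤˣ) : s * a * (s * b) = a * b := by
  rw [mul_mul_mul_comm, Int.units_mul_self, one_mul]

/-- `s (s a) = a` in `ℤˣ`. [folklore] -/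
private theorem wrs_units_cancel' (s a : ℤˣ) : s * (s * a) = a := by
  rw [← mul_assoc, Int.units_mul_self, one_mul]

/-- `s · s = 1` in `ℝ` for `s ∈ ℤˣ`. [folklore] -/
private theorem wrs_cast_mul_self (s : ℤˣ) : ((s : ℤ) : ℝ) * ((s : ℤ) : ℝ) = 1 := by
  rw [← Int.cast_mul, Int.units_coe_mul_self, Int.cast_one]

/-! ## The wheel Hamiltonian and weight -/

/-- The wheel Hamiltonian: `∑_i Kw_i σ_{C_i} = ∑_k (K_k σ_k σ_{k+1} + h_k σ_hub σ_k)`. [folklore] -/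
private theorem wrs_hamiltonian {n : ℕ} (hn : 2 ≤ n) (K h : Fin n → ℝ)
    (ω : SpinConfig (Fin (n + 1))) :
    gksHamiltonian Finset.univ (Fin.append K h)
      (Fin.append (fun k : Fin n => ({k.castSucc, (finRotate n k).castSucc} : Finset (Fin (n + 1))))
        (fun k : Fin n => ({Fin.last n, k.castSucc} : Finset (Fin (n + 1))))) ω =
      ∑ k : Fin n, (K k * (spinAt k.castSucc ω * spinAt (finRotate n k).castSucc ω) +
        h k * (spinAt (Fin.last n) ω * spinAt k.castSucc ω)) := by
  rw [gksHamiltonian, Fin.sum_univ_add, Finset.sum_add_distrib]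
  simp only [Fin.append_left, Fin.append_right]
  congr 1
  · refine Finset.sum_congr rfl fun k _ => ?_
    rw [wrs_spinProduct_pair]
    exact fun heq => wrs_finRotate_ne hn k (Fin.castSucc_injective _ heq).symm
  · refine Finset.sum_congr rfl fun k _ => ?_
    rw [wrs_spinProduct_pair]
    exact (Fin.castSucc_lt_last k).ne'

/-- The wheel weight in terms of units products: `exp(∑_k (K_k (ω_k ω_{k+1}) + h_k (ω_hub ω_k)))`.
[folklore] -/
private theorem wrs_weight {n : ℕ} (hn : 2 ≤ n) (K h : Fin n → ℝ)
    (ω : SpinConfig (Fin (n + 1))) :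
    gksWeight Finset.univ (Fin.append K h)
      (Fin.append (fun k : Fin n => ({k.castSucc, (finRotate n k).castSucc} : Finset (Fin (n + 1))))
        (fun k : Fin n => ({Fin.last n, k.castSucc} : Finset (Fin (n + 1))))) ω =
      Real.exp (∑ k : Fin n, (K k * (((ω k.castSucc * ω (finRotate n k).castSucc : ℤˣ) : ℤ) : ℝ) +
        h k * (((ω (Fin.last n) * ω k.castSucc : ℤˣ) : ℤ) : ℝ))) := by
  rw [gksWeight, wrs_hamiltonian hn]
  simp only [spinAt, Units.val_mul, Int.cast_mul]

/-! ## Splitting a wheel configuration into hub spin and relative rim configuration -/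

/-- `∑_ω G(ω) = ∑_{s = ±1} ∑_y G(Fin.snoc (s • y) s)`: split off the hub spin (`Fin.snocEquiv`) and
relabel the rim configuration by `y ↦ s • y` (`Equiv.mulLeft`). [folklore] -/
private theorem wrs_sum_snoc {n : ℕ} (G : SpinConfig (Fin (n + 1)) → ℝ) :
    ∑ ω, G ω = ∑ s : ℤˣ, ∑ y : Fin n → ℤˣ, G (Fin.snoc (α := fun _ => ℤˣ) (fun k => s * y k) s) := by
  calc ∑ ω, G ω = ∑ p : ℤˣ × (Fin n → ℤˣ), G (Fin.snocEquiv (fun _ => ℤˣ) p) :=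
        ((Fin.snocEquiv fun _ => ℤˣ).sum_comp G).symm
    _ = ∑ s : ℤˣ, ∑ y : Fin n → ℤˣ, G (Fin.snocEquiv (fun _ => ℤˣ) (s, y)) :=
        Fintype.sum_prod_type _
    _ = ∑ s : ℤˣ, ∑ y : Fin n → ℤˣ, G (Fin.snoc (α := fun _ => ℤˣ) (fun k => s * y k) s) := by
        refine Finset.sum_congr rfl fun s _ => ?_
        exact (Equiv.sum_comp (Equiv.mulLeft fun _ : Fin n => s)
          (fun y => G (Fin.snoc (α := fun _ => ℤˣ) y s))).symm

/-- **Apex reduction.**  If the observable `F` reads `f y` on `Fin.snoc (s • y) s` for both hub spins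
`s`, then `Z⟨F⟩_wheel = 2 ∑_y f(y) w(y)` with the ring weight
`w y = exp(∑ K_k y_k y_{k+1} + ∑ h_k y_k)`. [folklore] -/
private theorem wrs_gksSum {n : ℕ} (hn : 2 ≤ n) (K h : Fin n → ℝ)
    (F : SpinConfig (Fin (n + 1)) → ℝ) (f : (Fin n → ℤˣ) → ℝ)
    (hF : ∀ (s : ℤˣ) (y : Fin n → ℤˣ), F (Fin.snoc (α := fun _ => ℤˣ) (fun k => s * y k) s) = f y) :
    gksSum Finset.univ (Fin.append K h)
      (Fin.append (fun k : Fin n => ({k.castSucc, (finRotate n k).castSucc} : Finset (Fin (n + 1))))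
        (fun k : Fin n => ({Fin.last n, k.castSucc} : Finset (Fin (n + 1))))) F =
      2 * ∑ y : Fin n → ℤˣ, f y * Real.exp (∑ k : Fin n,
        (K k * (((y k : ℤ) : ℝ) * ((y (finRotate n k) : ℤ) : ℝ)) + h k * ((y k : ℤ) : ℝ))) := by
  rw [gksSum, wrs_sum_snoc]
  have key : ∀ s : ℤˣ, ∑ y : Fin n → ℤˣ, F (Fin.snoc (α := fun _ => ℤˣ) (fun k => s * y k) s) *
      gksWeight Finset.univ (Fin.append K h)
        (Fin.append (fun k : Fin n => ({k.castSucc, (finRotate n k).castSucc} : Finset (Fin (n + 1))))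
          (fun k : Fin n => ({Fin.last n, k.castSucc} : Finset (Fin (n + 1)))))
        (Fin.snoc (α := fun _ => ℤˣ) (fun k => s * y k) s) =
      ∑ y : Fin n → ℤˣ, f y * Real.exp (∑ k : Fin n,
        (K k * (((y k : ℤ) : ℝ) * ((y (finRotate n k) : ℤ) : ℝ)) + h k * ((y k : ℤ) : ℝ))) := by
    intro s
    refine Finset.sum_congr rfl fun y _ => ?_
    rw [hF, wrs_weight hn]
    simp only [Fin.snoc_castSucc, Fin.snoc_last]
    simp only [wrs_units_cancel, wrs_units_cancel']
    simp only [Units.val_mul, Int.cast_mul]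
  rw [Finset.sum_congr rfl fun s _ => key s]
  simp only [Finset.sum_const, Finset.card_univ, Fintype.card_units_int, nsmul_eq_mul, Nat.cast_ofNat]

/-! ## Positivity of the hub–rim correlation -/

/-- `∑_y y_i e^{c y_i} > 0` for `c > 0` (pair `y` with `-y`: each pair contributes `e^c - e^{-c}`).
[folklore] -/
private theorem wrs_single_pos {n : ℕ} (i : Fin n) {c : ℝ} (hc : 0 < c) :
    0 < ∑ y : Fin n → ℤˣ, ((y i : ℤ) : ℝ) * Real.exp (c * ((y i : ℤ) : ℝ)) := by
  set g : (Fin n → ℤˣ) → ℝ := fun y => ((y i : ℤ) : ℝ) * Real.exp (c * ((y i : ℤ) : ℝ)) with hg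
  have hflip : ∑ y : Fin n → ℤˣ, g (-y) = ∑ y, g y := Equiv.sum_comp (Equiv.neg _) g
  have hterm : ∀ y : Fin n → ℤˣ, g y + g (-y) = Real.exp c - Real.exp (-c) := by
    intro y
    simp only [hg, Pi.neg_apply, Units.val_neg, Int.cast_neg]
    rcases Int.units_eq_one_or (y i) with hy | hy <;>
      simp only [hy, Units.val_one, Units.val_neg, Int.cast_one, Int.cast_neg, mul_one, mul_neg,
        one_mul, neg_mul, neg_neg] <;> ring
  have h2 : 2 * ∑ y, g y = ∑ y : Fin n → ℤˣ, (g y + g (-y)) := by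
    rw [Finset.sum_add_distrib, hflip, two_mul]
  have h3 : 0 < 2 * ∑ y, g y := by
    rw [h2, Finset.sum_congr rfl fun y _ => hterm y]
    refine Finset.sum_pos (fun _ _ => ?_) Finset.univ_nonempty
    exact sub_pos.2 (Real.exp_lt_exp.2 (by linarith))
  linarith

/-- **`⟨σ_hub σ_i⟩_wheel > 0`** for `K ≥ 0`, `h > 0`: Griffiths' comparison with the single spoke `i`,
whose expectation is the explicit positive ratio of `wrs_single_pos` and a sum of exponentials.
[folklore] -/
private theorem wrs_spoke_pos {n : ℕ} (hn : 2 ≤ n) (K h : Fin n → ℝ) (hK : ∀ k, 0 ≤ K k)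
    (hh : ∀ k, 0 < h k) (i : Fin n) :
    0 < gksExpect Finset.univ (Fin.append K h)
      (Fin.append (fun k : Fin n => ({k.castSucc, (finRotate n k).castSucc} : Finset (Fin (n + 1))))
        (fun k : Fin n => ({Fin.last n, k.castSucc} : Finset (Fin (n + 1)))))
      (fun ω => spinAt (Fin.last n) ω * spinAt i.castSucc ω) := by
  have hpair : (fun ω : SpinConfig (Fin (n + 1)) => spinAt (Fin.last n) ω * spinAt i.castSucc ω) =
      spinProduct ({Fin.last n, i.castSucc} : Finset (Fin (n + 1))) := by
    funext ω
    exact (wrs_spinProduct_pair (Fin.castSucc_lt_last i).ne' ω).symm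
  have hK' : ∀ j ∈ (Finset.univ : Finset (Fin (n + n))),
      |Fin.append (fun _ : Fin n => (0 : ℝ)) (Pi.single i (h i)) j| ≤ Fin.append K h j := by
    intro j _
    refine Fin.addCases (fun k => ?_) (fun k => ?_) j
    · simp only [Fin.append_left, abs_zero]
      exact hK k
    · simp only [Fin.append_right, Pi.single_apply]
      split_ifs with hki
      · subst hki
        exact (abs_of_pos (hh _)).le
      · rw [abs_zero]
        exact (hh k).le
  have hF : ∀ (s : ℤˣ) (y : Fin n → ℤˣ),
      spinAt (Fin.last n) (Fin.snoc (α := fun _ => ℤˣ) (fun k => s * y k) s) *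
        spinAt i.castSucc (Fin.snoc (α := fun _ => ℤˣ) (fun k => s * y k) s) = ((y i : ℤ) : ℝ) := by
    intro s y
    simp only [spinAt, Fin.snoc_castSucc, Fin.snoc_last, Units.val_mul, Int.cast_mul]
    linear_combination ((y i : ℤ) : ℝ) * wrs_cast_mul_self s
  rw [hpair]
  refine lt_of_lt_of_le ?_ (gksExpect_mono_of_abs_le Finset.univ _ hK' _)
  rw [← hpair, gksExpect, wrs_gksSum hn (fun _ => (0 : ℝ)) (Pi.single i (h i)) _ _ hF,
    wrs_gksSum hn (fun _ => (0 : ℝ)) (Pi.single i (h i)) (fun _ => 1) (fun _ => 1) fun _ _ => rfl]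
  refine div_pos (mul_pos two_pos ?_) (mul_pos two_pos ?_)
  · have hw : ∀ y : Fin n → ℤˣ, (∑ k : Fin n, ((0 : ℝ) * (((y k : ℤ) : ℝ) * ((y (finRotate n k) : ℤ) : ℝ)) +
        (Pi.single i (h i) : Fin n → ℝ) k * ((y k : ℤ) : ℝ))) = h i * ((y i : ℤ) : ℝ) := by
      intro y
      simp only [zero_mul, zero_add, Pi.single_apply, ite_mul, Finset.sum_ite_eq', Finset.mem_univ,
        if_true]
    simp only [hw]
    exact wrs_single_pos i (hh i)
  · exact Finset.sum_pos (fun y _ => by positivity) Finset.univ_nonempty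

/-! ## Stub B: wheel correlations are ring sums with a field (hub conditioned to `+`) -/

/-- **Stub B (ring sums).**  For the wheel with rim couplings `K` and spoke couplings `h`, every entry of the
spin second-moment matrix is a ratio of ring sums with weight `exp(∑ K_k x_k x_{k+1} + ∑ h_k x_k)`; the ring
partition sum is positive and, for positive spokes, so are the one-point ring sums. [folklore] -/
theorem stub_wheel_ringsum :
    ∀ (n : ℕ), 3 ≤ n → ∀ (K h : Fin n → ℝ), (∀ k, 0 ≤ K k) → (∀ k, 0 < h k) →
      let w : (Fin n → ℤˣ) → ℝ := fun x =>
        Real.exp (∑ k : Fin n, (K k * (((x k : ℤ) : ℝ) * ((x (finRotate n k) : ℤ) : ℝ)) + h k * ((x k : ℤ) : ℝ)))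
      let Zr : ℝ := ∑ x : Fin n → ℤˣ, w x
      let A : Fin n → ℝ := fun i => ∑ x : Fin n → ℤˣ, w x * ((x i : ℤ) : ℝ)
      let B : Fin n → Fin n → ℝ := fun i j => ∑ x : Fin n → ℤˣ, w x * ((x i : ℤ) : ℝ) * ((x j : ℤ) : ℝ)
      let C : Fin (n + n) → Finset (Fin (n + 1)) :=
        Fin.append (fun k : Fin n => ({k.castSucc, (finRotate n k).castSucc} : Finset (Fin (n + 1))))
          (fun k : Fin n => ({Fin.last n, k.castSucc} : Finset (Fin (n + 1))))
      let Kw : Fin (n + n) → ℝ := Fin.append K h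
      0 < Zr ∧ (∀ i, 0 < A i) ∧
      (∀ i j : Fin n, gksExpect Finset.univ Kw C (fun ω => spinAt i.castSucc ω * spinAt j.castSucc ω) = B i j / Zr) ∧
      (∀ i : Fin n, gksExpect Finset.univ Kw C (fun ω => spinAt (Fin.last n) ω * spinAt i.castSucc ω) = A i / Zr) ∧
      (∀ i : Fin n, gksExpect Finset.univ Kw C (fun ω => spinAt i.castSucc ω * spinAt (Fin.last n) ω) = A i / Zr) ∧
      gksExpect Finset.univ Kw C (fun ω => spinAt (Fin.last n) ω * spinAt (Fin.last n) ω) = 1 := by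
  intro n hn K h hK hh w Zr A B C Kw
  have hn2 : 2 ≤ n := by omega
  have h2 : (2 : ℝ) ≠ 0 := two_ne_zero
  -- the apex reduction, specialised to the couplings `Kw`
  have hred : ∀ (F : SpinConfig (Fin (n + 1)) → ℝ) (f : (Fin n → ℤˣ) → ℝ),
      (∀ (s : ℤˣ) (y : Fin n → ℤˣ), F (Fin.snoc (α := fun _ => ℤˣ) (fun k => s * y k) s) = f y) →
      gksSum Finset.univ Kw C F = 2 * ∑ y, f y * w y :=
    fun F f hF => wrs_gksSum hn2 K h F f hF
  -- partition function
  have hZ : gksSum Finset.univ Kw C (fun _ => 1) = 2 * Zr := by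
    rw [hred (fun _ => 1) (fun _ => 1) fun _ _ => rfl]
    simp only [one_mul]
    rfl
  have hZr : 0 < Zr := Finset.sum_pos (fun x _ => Real.exp_pos _) Finset.univ_nonempty
  -- rim–rim
  have hB : ∀ i j : Fin n,
      gksSum Finset.univ Kw C (fun ω => spinAt i.castSucc ω * spinAt j.castSucc ω) = 2 * B i j := by
    intro i j
    have hF : ∀ (s : ℤˣ) (y : Fin n → ℤˣ),
        spinAt i.castSucc (Fin.snoc (α := fun _ => ℤˣ) (fun k => s * y k) s) *
          spinAt j.castSucc (Fin.snoc (α := fun _ => ℤˣ) (fun k => s * y k) s) =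
        ((y i : ℤ) : ℝ) * ((y j : ℤ) : ℝ) := by
      intro s y
      simp only [spinAt, Fin.snoc_castSucc, Units.val_mul, Int.cast_mul]
      linear_combination (((y i : ℤ) : ℝ) * ((y j : ℤ) : ℝ)) * wrs_cast_mul_self s
    rw [hred _ _ hF]
    show 2 * ∑ y, ((y i : ℤ) : ℝ) * ((y j : ℤ) : ℝ) * w y =
      2 * ∑ x, w x * ((x i : ℤ) : ℝ) * ((x j : ℤ) : ℝ)
    congr 1
    exact Finset.sum_congr rfl fun y _ => by ring
  -- hub–rim
  have hA : ∀ i : Fin n,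
      gksSum Finset.univ Kw C (fun ω => spinAt (Fin.last n) ω * spinAt i.castSucc ω) = 2 * A i := by
    intro i
    have hF : ∀ (s : ℤˣ) (y : Fin n → ℤˣ),
        spinAt (Fin.last n) (Fin.snoc (α := fun _ => ℤˣ) (fun k => s * y k) s) *
          spinAt i.castSucc (Fin.snoc (α := fun _ => ℤˣ) (fun k => s * y k) s) = ((y i : ℤ) : ℝ) := by
      intro s y
      simp only [spinAt, Fin.snoc_castSucc, Fin.snoc_last, Units.val_mul, Int.cast_mul]
      linear_combination ((y i : ℤ) : ℝ) * wrs_cast_mul_self s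
    rw [hred _ _ hF]
    show 2 * ∑ y, ((y i : ℤ) : ℝ) * w y = 2 * ∑ x, w x * ((x i : ℤ) : ℝ)
    congr 1
    exact Finset.sum_congr rfl fun y _ => by ring
  have hcomm : ∀ i : Fin n,
      (fun ω : SpinConfig (Fin (n + 1)) => spinAt i.castSucc ω * spinAt (Fin.last n) ω) =
        fun ω => spinAt (Fin.last n) ω * spinAt i.castSucc ω :=
    fun i => funext fun ω => mul_comm _ _
  have hexpA : ∀ i : Fin n,
      gksExpect Finset.univ Kw C (fun ω => spinAt (Fin.last n) ω * spinAt i.castSucc ω) = A i / Zr := by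
    intro i
    rw [gksExpect, hA, hZ, mul_div_mul_left _ _ h2]
  refine ⟨hZr, ?_, ?_, hexpA, ?_, ?_⟩
  · -- positivity of the one-point ring sums
    intro i
    have hpos := wrs_spoke_pos hn2 K h hK hh i
    have hpos' : 0 < A i / Zr := by rw [← hexpA]; exact hpos
    exact (div_pos_iff_of_pos_right hZr).1 hpos'
  · intro i j
    rw [gksExpect, hB, hZ, mul_div_mul_left _ _ h2]
  · intro i
    rw [hcomm, hexpA]
  · have h1 : (fun ω : SpinConfig (Fin (n + 1)) => spinAt (Fin.last n) ω * spinAt (Fin.last n) ω) =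
        fun _ => 1 := funext fun ω => spinAt_mul_self _ _
    rw [h1, gksExpect]
    exact div_self (gksSum_one_pos _ _ _).ne'

end

end Summit.CriticalPhenomena.Ising3DConformalLimit.Cruxes.InverseMFerromagnet.PartialCovarianceLadder
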